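import Summits.CriticalPhenomena.SAWScalingLimit.Theses.SAWAsymptoticMorera
import Literature.Probability.RandomPlanarGeometry.HexParafermionProofs

/-!
# `SAWAsymptoticMorera.Z2VertexIdentity` (stmt-CriticalPhenomena-6859) — preliminaries

Route `SAWAsymptoticMorera` of `CriticalPhenomena/SAWScalingLimit`, support item
`Z2VertexIdentity` (the square-lattice Duminil-Copin–Smirnov vertex identity with remainder).
This file holds the combinatorial and geometric groundwork for the regrouping argument of
[DuminilCopinSmirnov2012, proof of Lemma 1] transposed to `ℤ²`; the identity itself is assembled
in `SAWAsymptoticMoreraZ2VertexIdentity.lean`.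

## Contents (namespace `Summit.CriticalPhenomena.SAWScalingLimit.Theorems.Z2Vertex`)

* `dir4`, `cdir4` — the four unit steps of `ℤ²` (as sites and as `1, i, -1, -i`) and their
  arithmetic (`dir4_add_two`, `add_dir4_eq_sub_dir4_iff`, `exists_eq_sub_dir4_of_adj`, …);
* `finite_domainSAW_of_finite` — the SAW spaces `DomainSAW Ω δ u w` are finite when `Ω_δ` is
  finite (in particular for bounded `Ω` and `δ > 0`, `meshDomain_finite`);
* `TSet`, `extend`, `extend_bijective`, `tsum_eq_sum_tsum_extend` — walks `a → v` (`v ≠ a`)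
  are in bijection with pairs (last step `k`, walk `a → v - dir4 k` never visiting `v`)
  (`SimpleGraph.Walk.concat`), and a sum over the walks to `v` regroups accordingly;
* `pathWeight`, `turning_step`, `pathWeight_extend`, `mem_edges_extend_iff` — the half-edge
  parafermionic weight `e^{-i(5/8)W} x_c^{n+1}` (winding from a reference site `a'`), and what a
  one-step prolongation does to it: weight `× x_c e^{-i(5/8)θ}` with `θ = arg (cdir4 i / cdir4 k)`
  the turning angle at `v` (winding additivity `winding_concat₃`, `winding_concat_right_ray`).
-/

noncomputable section

open Literature.Probability.LatticeModels Literature.Probability.RandomPlanarGeometry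
open Literature.Probability.RandomPlanarGeometry.SAW Complex

namespace Summit.CriticalPhenomena.SAWScalingLimit.Theorems.Z2Vertex
-- buildfix lane 2026-08-20: namespace-local alias(es) so that short names made ambiguous by the
-- 2026-08-15 Literature migration (old home vs re-exported new home, both in the import cone) resolve,
-- as in the accepted build (alias target `Polyline.turning`, the copy `pathWeight` and the winding lemmas use). No declaration text changes.
export Literature.Probability.LatticeModels.Polyline (turning)

/-! ### The four lattice directions -/

/-- The four unit steps of `ℤ²`, counter-clockwise from east. [folklore] -/
def dir4 : Fin 4 → Site 2 := ![![1, 0], ![0, 1], ![-1, 0], ![0, -1]]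

/-- The four unit steps as complex numbers `1, i, -1, -i`. [folklore] -/
def cdir4 : Fin 4 → ℂ := ![1, I, -1, -I]

/-- The embedded direction vectors are `1, i, -1, -i`. [folklore] -/
theorem toComplex_dir4 (k : Fin 4) : Site.toComplex (dir4 k) = cdir4 k := by
  fin_cases k <;> apply Complex.ext <;> simp [Site.toComplex, dir4, cdir4]

/-- Opposite directions: `dir4 (k + 2) = -dir4 k`. [folklore] -/
theorem dir4_add_two (k : Fin 4) : dir4 (k + 2) = -dir4 k := by
  fin_cases k <;> (ext j; fin_cases j <;> rfl)

/-- Opposite directions: `cdir4 (k + 2) = -cdir4 k`. [folklore] -/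
theorem cdir4_add_two (k : Fin 4) : cdir4 (k + 2) = -cdir4 k := by
  fin_cases k <;> simp [cdir4]

/-- The complex directions are non-zero. [folklore] -/
theorem cdir4_ne_zero (k : Fin 4) : cdir4 k ≠ 0 := by
  fin_cases k <;> simp [cdir4, I_ne_zero]

/-- `dir4` is injective. [folklore] -/
theorem dir4_injective : Function.Injective dir4 := by
  intro i j h
  fin_cases i <;> fin_cases j <;> first
    | rfl
    | (exfalso; have h0 := congrFun h 0; have h1 := congrFun h 1; simp [dir4] at h0 h1)

/-- `v + dir4 i = v - dir4 k` exactly when `i` and `k` are opposite. [folklore] -/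
theorem add_dir4_eq_sub_dir4_iff (v : Site 2) (i k : Fin 4) :
    v + dir4 i = v - dir4 k ↔ i = k + 2 := by
  constructor
  · intro h
    have h' : dir4 i = dir4 (k + 2) := by
      rw [dir4_add_two]
      have := congrArg (fun w => w - v) h
      simpa [sub_eq_add_neg] using this
    exact dir4_injective h'
  · rintro rfl
    rw [dir4_add_two, sub_eq_add_neg]

/-- A `ℤ²`-neighbour `x` of `v` is `v - dir4 k` for some `k`. [folklore] -/
theorem exists_eq_sub_dir4_of_adj {x v : Site 2} (h : (zdGraph 2).Adj x v) :
    ∃ k : Fin 4, x = v - dir4 k := by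
  obtain ⟨i, hi | hi⟩ := (zdGraph_adj_iff x v).1 h
  · fin_cases i
    · refine ⟨0, ?_⟩
      rw [hi]; ext j; fin_cases j <;> simp [dir4]
    · refine ⟨1, ?_⟩
      rw [hi]; ext j; fin_cases j <;> simp [dir4]
  · fin_cases i
    · refine ⟨2, ?_⟩
      rw [hi]; ext j; fin_cases j <;> simp [dir4]
    · refine ⟨3, ?_⟩
      rw [hi]; ext j; fin_cases j <;> simp [dir4]


/-! ### Finiteness of the walk spaces -/

section Finite

variable {Ω : Set ℂ} {δ : ℝ}

/-- The vertices of a walk of `Ω_δ` are its starting point or sites of `Ω_δ`. [folklore] -/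
-- adapted from Summits/CriticalPhenomena/SAWScalingLimit/Theorems/SAWLoopFugacityFlowAssembly.lean
theorem mem_support_walk {u w : Site 2} (p : (discreteDomainGraph Ω δ).Walk u w) :
    ∀ x ∈ p.support, x = u ∨ x ∈ meshDomain Ω δ := by
  induction p with
  | nil =>
    intro x hx
    rw [SimpleGraph.Walk.support_nil, List.mem_singleton] at hx
    exact Or.inl hx
  | cons h p ih =>
    intro x hx
    rw [SimpleGraph.Walk.support_cons, List.mem_cons] at hx
    rcases hx with rfl | hx
    · exact Or.inl rfl
    · rcases ih x hx with rfl | hx'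
      · exact Or.inr (discreteDomainGraph_adj_iff.1 h).2.2
      · exact Or.inr hx'

/-- A SAW of `Ω_δ` is determined by its underlying walk. [folklore] -/
theorem DomainSAW.ext_walk {u w : Site 2} {γ γ' : DomainSAW Ω δ u w} (h : γ.walk = γ'.walk) :
    γ = γ' := by
  cases γ; cases γ'; cases h; rfl

/-- **Finiteness of the walk spaces**: if the discrete domain `Ω_δ` is finite there are finitely
many SAWs of `Ω_δ` between two given sites (their supports are duplicate-free lists over the
finite set `{u} ∪ Ω_δ`). [folklore] -/
-- adapted from Summits/CriticalPhenomena/SAWScalingLimit/Theorems/SAWLoopFugacityFlowAssembly.lean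
theorem finite_domainSAW_of_finite (hΩ : (meshDomain Ω δ).Finite) (u w : Site 2) :
    Finite (DomainSAW Ω δ u w) := by
  classical
  set S : Set (Site 2) := insert u (meshDomain Ω δ) with hSdef
  have hfin : S.Finite := hΩ.insert u
  haveI : Fintype ↥S := hfin.fintype
  have hsupp : ∀ (γ : DomainSAW Ω δ u w), ∀ x ∈ γ.walk.support, x ∈ S := by
    intro γ x hx
    rcases mem_support_walk γ.walk x hx with rfl | h
    · exact Set.mem_insert _ _
    · exact Set.mem_insert_of_mem _ h
  let f : DomainSAW Ω δ u w → {l : List ↥S // l.length ≤ Fintype.card ↥S} :=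
    fun γ => ⟨γ.walk.support.pmap (fun x hx => ⟨x, hx⟩) (hsupp γ), by
      rw [List.length_pmap]
      have hnd : (γ.walk.support.pmap (fun x hx => (⟨x, hx⟩ : ↥S)) (hsupp γ)).Nodup := by
        refine List.Nodup.pmap ?_ γ.isPath.support_nodup
        intro a ha b hb h
        exact congrArg Subtype.val h
      have := hnd.length_le_card
      rwa [List.length_pmap] at this⟩
  haveI : Finite {l : List ↥S // l.length ≤ Fintype.card ↥S} :=
    (List.finite_length_le _ _).to_subtype
  refine Finite.of_injective f fun γ γ' h => ?_
  apply DomainSAW.ext_walk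
  apply SimpleGraph.Walk.support_injective
  have h' :=
    congrArg (fun l : {l : List ↥S // l.length ≤ Fintype.card ↥S} => l.1.map Subtype.val) h
  simpa [f, List.map_pmap] using h'

end Finite

/-! ### Walks to `v` grouped by their last step -/

section LastStep

variable {Ω : Set ℂ} {δ : ℝ} {a v : Site 2}

/-- The 'type-1' class in direction `k`: SAWs `a → v - dir4 k` of `Ω_δ` that never visit `v`.
[cite: DuminilCopinSmirnov2012, proof of Lemma 1] -/
def TSet (Ω : Set ℂ) (δ : ℝ) (a v : Site 2) (k : Fin 4) : Set (DomainSAW Ω δ a (v - dir4 k)) :=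
  {γ | v ∉ γ.walk.support}

/-- Membership in the type-1 class. [folklore] -/
@[simp] theorem mem_TSet {k : Fin 4} {γ : DomainSAW Ω δ a (v - dir4 k)} :
    γ ∈ TSet Ω δ a v k ↔ v ∉ γ.walk.support := Iff.rfl

/-- Prolonging a type-1 walk `a → v - dir4 k` by the step to `v`. [cite: DuminilCopinSmirnov2012, proof of Lemma 1] -/
def extend (hadj : ∀ k, (discreteDomainGraph Ω δ).Adj (v - dir4 k) v) (k : Fin 4)
    (γ : TSet Ω δ a v k) : DomainSAW Ω δ a v :=
  ⟨γ.1.walk.concat (hadj k), γ.1.isPath.concat γ.2 (hadj k)⟩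

/-- The underlying walk of the prolongation. [folklore] -/
@[simp] theorem extend_walk (hadj : ∀ k, (discreteDomainGraph Ω δ).Adj (v - dir4 k) v)
    (k : Fin 4) (γ : TSet Ω δ a v k) :
    (extend hadj k γ).walk = γ.1.walk.concat (hadj k) := rfl

/-- **Walks to `v ≠ a` are in bijection with (last step, type-1 walk) pairs.**
[cite: DuminilCopinSmirnov2012, proof of Lemma 1] -/
theorem extend_bijective (hadj : ∀ k, (discreteDomainGraph Ω δ).Adj (v - dir4 k) v)
    (hva : v ≠ a) :
    Function.Bijective (fun x : Σ k, TSet Ω δ a v k => extend hadj x.1 x.2) := by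
  constructor
  · rintro ⟨k₁, γ₁⟩ ⟨k₂, γ₂⟩ h
    have hw := congrArg DomainSAW.walk h
    simp only [extend_walk] at hw
    obtain ⟨hv, hcopy⟩ := SimpleGraph.Walk.concat_inj hw
    have hk : k₁ = k₂ := by
      apply dir4_injective
      have := congrArg (fun w => v - w) hv
      simpa using this
    subst hk
    have hγ : γ₁ = γ₂ := by
      apply Subtype.ext
      apply DomainSAW.ext_walk
      simpa using hcopy
    subst hγ
    rfl
  · rintro ⟨w, hw⟩
    cases w with
    | nil => exact absurd rfl hva
    | cons h p =>
      obtain ⟨x, q, h', hc⟩ := SimpleGraph.Walk.exists_cons_eq_concat h p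
      have hzd : (zdGraph 2).Adj x v :=
        meshGraph_le_zdGraph Ω δ (discreteDomainGraph_le_meshGraph Ω δ h')
      obtain ⟨k, rfl⟩ := exists_eq_sub_dir4_of_adj hzd
      rw [hc] at hw
      obtain ⟨hq, hvq⟩ := (SimpleGraph.Walk.concat_isPath_iff h').1 hw
      refine ⟨⟨k, ⟨⟨q, hq⟩, hvq⟩⟩, ?_⟩
      apply DomainSAW.ext_walk
      simp only [extend_walk]
      exact hc.symm

/-- **Regrouping a sum over the walks to `v` by their last step** (finite walk spaces).
[cite: DuminilCopinSmirnov2012, proof of Lemma 1] -/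
theorem tsum_eq_sum_tsum_extend (hfin : ∀ p, Finite (DomainSAW Ω δ a p))
    (hadj : ∀ k, (discreteDomainGraph Ω δ).Adj (v - dir4 k) v) (hva : v ≠ a)
    (f : DomainSAW Ω δ a v → ℂ) :
    ∑' γ, f γ = ∑ k : Fin 4, ∑' γ : TSet Ω δ a v k, f (extend hadj k γ) := by
  classical
  haveI : ∀ p, Fintype (DomainSAW Ω δ a p) := fun p => Fintype.ofFinite _
  rw [tsum_fintype]
  simp_rw [tsum_fintype]
  rw [← Fintype.sum_sigma' (fun k (γ : TSet Ω δ a v k) => f (extend hadj k γ))]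
  exact (Fintype.sum_bijective _ (extend_bijective hadj hva) _ _ fun _ => rfl).symm

end LastStep

/-! ### The half-edge weight and its behaviour under a one-step prolongation -/

section Weight

variable {Ω : Set ℂ} {δ : ℝ} {a v : Site 2}

/-- The weight `e^{-i(5/8) W} x_c^{n+1}` of a lattice path with vertex list `l` (as sites),
started from the reference site `a'` and continued to the point `m` (a mid-edge), `W` the winding
of the polyline `δa', δl₀, …, δlₙ, m`. [cite: DuminilCopinSmirnov2012, Def. 1] -/
def pathWeight (δ : ℝ) (a' : Site 2) (l : List (Site 2)) (m : ℂ) (n : ℕ) : ℂ :=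
  Complex.exp (-Complex.I * (5 / 8 : ℂ) *
      (Literature.Probability.LatticeModels.Polyline.winding
        (meshPoint δ a' :: (l.map (meshPoint δ)) ++ [m]) : ℝ)) *
    (criticalFugacity : ℂ) ^ (n + 1)

/-- One lattice step forward moves the mesh point by `δ · cdir4 i`. [folklore] -/
theorem meshPoint_add_dir4 (δ : ℝ) (v : Site 2) (i : Fin 4) :
    meshPoint δ (v + dir4 i) = meshPoint δ v + (δ : ℂ) * cdir4 i := by
  rw [← toComplex_dir4, meshPoint, meshPoint, ← mul_add]
  congr 1
  apply Complex.ext <;> simp [Site.toComplex]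

/-- One lattice step back moves the mesh point by `-δ · cdir4 k`. [folklore] -/
theorem meshPoint_sub_dir4 (δ : ℝ) (v : Site 2) (k : Fin 4) :
    meshPoint δ (v - dir4 k) = meshPoint δ v - (δ : ℂ) * cdir4 k := by
  rw [← toComplex_dir4, meshPoint, meshPoint, ← mul_sub]
  congr 1
  apply Complex.ext <;> simp [Site.toComplex]

/-- The midpoint of the edge `{u, w}` lies half-way along it from `u`. [folklore] -/
theorem medialPoint_eq_ray (δ : ℝ) (u w : Site 2) :
    medialPoint δ s(u, w) = meshPoint δ u + ((1 / 2 : ℝ) : ℂ) * (meshPoint δ w - meshPoint δ u) := by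
  rw [medialPoint_mk]; push_cast; ring

/-- **The turning angle at `v`** of the prolonged configuration: arriving along `dir4 k` and
leaving toward the middle of the edge in direction `dir4 i` turns by `arg (cdir4 i / cdir4 k)`
(`0`, `±π/2`; `π` for the excluded reversal). [folklore] -/
theorem turning_step (hδ : 0 < δ) (v : Site 2) (k i : Fin 4) :
    turning (meshPoint δ (v - dir4 k)) (meshPoint δ v) (medialPoint δ s(v, v + dir4 i)) =
      Complex.arg (cdir4 i / cdir4 k) := by
  unfold turning
  have hδ0 : (δ : ℂ) ≠ 0 := Complex.ofReal_ne_zero.2 hδ.ne'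
  have h1 : medialPoint δ s(v, v + dir4 i) - meshPoint δ v = (δ : ℂ) * cdir4 i * ((1 / 2 : ℝ) : ℂ) := by
    rw [medialPoint_mk, meshPoint_add_dir4]; push_cast; ring
  have h2 : meshPoint δ v - meshPoint δ (v - dir4 k) = (δ : ℂ) * cdir4 k := by
    rw [meshPoint_sub_dir4]; ring
  rw [h1, h2, show (δ : ℂ) * cdir4 i * ((1 / 2 : ℝ) : ℂ) / ((δ : ℂ) * cdir4 k) =
    cdir4 i / cdir4 k * ((1 / 2 : ℝ) : ℂ) by field_simp]
  exact Complex.arg_mul_real (by norm_num) _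

/-- **Weight of the one-step prolongation**: prolonging a type-1 walk `γ : a → v - dir4 k` by the
step to `v` and the half-edge toward `v + dir4 i` multiplies its half-edge weight (toward `v`) by
`x_c e^{-i(5/8) θ}`, `θ = arg (cdir4 i / cdir4 k)` the turning angle at `v`.
[cite: DuminilCopinSmirnov2012, proof of Lemma 1] -/
theorem pathWeight_extend (hδ : 0 < δ) (a' : Site 2) (hadj : ∀ k, (discreteDomainGraph Ω δ).Adj (v - dir4 k) v)
    (k i : Fin 4) (γ : DomainSAW Ω δ a (v - dir4 k)) :
    pathWeight δ a' (γ.walk.concat (hadj k)).support (medialPoint δ s(v, v + dir4 i))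
        (γ.walk.concat (hadj k)).length =
      (criticalFugacity : ℂ) * Complex.exp (-Complex.I * (5 / 8 : ℂ) * (Complex.arg (cdir4 i / cdir4 k) : ℝ)) *
        pathWeight δ a' γ.walk.support (medialPoint δ s(v - dir4 k, v)) γ.length := by
  -- the vertex list of `γ` ends at `u = v - dir4 k`
  obtain ⟨L, hL⟩ : ∃ L : List (Site 2), γ.walk.support = L ++ [v - dir4 k] :=
    ⟨γ.walk.support.dropLast, by
      conv_lhs => rw [← List.dropLast_append_getLast (SimpleGraph.Walk.support_ne_nil γ.walk)]
      rw [SimpleGraph.Walk.getLast_support]⟩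
  have hlen : (γ.walk.concat (hadj k)).length = γ.length + 1 := by
    rw [SimpleGraph.Walk.length_concat]; rfl
  rw [pathWeight, pathWeight, SimpleGraph.Walk.support_concat, hL, hlen]
  simp only [List.map_append, List.map_cons, List.map_nil, List.append_assoc, List.cons_append,
    List.nil_append]
  -- windings: split off the last turning angle, and move the last point along the last segment
  have hW1 : Literature.Probability.LatticeModels.Polyline.winding
      (meshPoint δ a' :: (List.map (meshPoint δ) L ++
        [meshPoint δ (v - dir4 k), meshPoint δ v, medialPoint δ s(v, v + dir4 i)])) =
      Literature.Probability.LatticeModels.Polyline.winding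
        (meshPoint δ a' :: (List.map (meshPoint δ) L ++ [meshPoint δ (v - dir4 k), meshPoint δ v])) +
      turning (meshPoint δ (v - dir4 k)) (meshPoint δ v) (medialPoint δ s(v, v + dir4 i)) := by
    rw [← List.cons_append, ← List.cons_append]
    exact winding_concat₃ _ _ _ _
  have hW2 : Literature.Probability.LatticeModels.Polyline.winding
      (meshPoint δ a' :: (List.map (meshPoint δ) L ++
        [meshPoint δ (v - dir4 k), medialPoint δ s(v - dir4 k, v)])) =
      Literature.Probability.LatticeModels.Polyline.winding
        (meshPoint δ a' :: (List.map (meshPoint δ) L ++ [meshPoint δ (v - dir4 k), meshPoint δ v])) := by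
    rw [← List.cons_append, ← List.cons_append, medialPoint_eq_ray]
    exact winding_concat_right_ray (t := 1 / 2) (by norm_num) _ _ _
  rw [hW1, hW2, turning_step hδ v k i]
  rw [Complex.ofReal_add, pow_succ]
  rw [show -Complex.I * (5 / 8 : ℂ) *
      ((Literature.Probability.LatticeModels.Polyline.winding (meshPoint δ a' ::
        (List.map (meshPoint δ) L ++ [meshPoint δ (v - dir4 k), meshPoint δ v])) : ℂ) +
        (Complex.arg (cdir4 i / cdir4 k) : ℂ)) =
      -Complex.I * (5 / 8 : ℂ) * (Literature.Probability.LatticeModels.Polyline.winding (meshPoint δ a' ::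
        (List.map (meshPoint δ) L ++ [meshPoint δ (v - dir4 k), meshPoint δ v])) : ℂ) +
      -Complex.I * (5 / 8 : ℂ) * (Complex.arg (cdir4 i / cdir4 k) : ℂ) by ring, Complex.exp_add]
  ring

/-- **The edge `{v, v + dir4 i}` is used by the prolonged walk iff it is its last step**, i.e.
iff `i` is opposite to `k` (a type-1 walk does not visit `v`). [folklore] -/
theorem mem_edges_extend_iff (hadj : ∀ k, (discreteDomainGraph Ω δ).Adj (v - dir4 k) v)
    (k i : Fin 4) (γ : TSet Ω δ a v k) :
    s(v, v + dir4 i) ∈ (γ.1.walk.concat (hadj k)).edges ↔ i = k + 2 := by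
  rw [SimpleGraph.Walk.edges_concat, List.concat_eq_append, List.mem_append, List.mem_singleton]
  constructor
  · rintro (h | h)
    · exact absurd (SimpleGraph.Walk.fst_mem_support_of_mem_edges _ h) γ.2
    · rw [Sym2.eq_iff] at h
      rcases h with ⟨h1, -⟩ | ⟨-, h2⟩
      · exfalso
        have : dir4 k = 0 := by
          have := congrArg (fun w => v - w) h1
          simpa [eq_comm] using this
        have h0 := congrFun this 0
        have h1' := congrFun this 1
        fin_cases k <;> simp [dir4] at h0 h1'
      · exact (add_dir4_eq_sub_dir4_iff v i k).1 h2
  · intro h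
    right
    rw [Sym2.eq_iff]
    exact Or.inr ⟨rfl, (add_dir4_eq_sub_dir4_iff v i k).2 h⟩

end Weight

end Summit.CriticalPhenomena.SAWScalingLimit.Theorems.Z2Vertex

end
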